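import Summits.BirchSwinnertonDyer.Rank1Residual.X1.StableCyclicQuotient
import Literature.NumberTheory.EllipticCurves.Rank1Residual.GVParityIsogenyProofs
import Literature.NumberTheory.EllipticCurves.MazurTorsionGaloisStructureProofs
import HarnessLib

/-!
# Route `SchneiderFreeAdditiveX3` (K1 door), crux `GordTwoBranchIMC` (stmt-BirchSwinnertonDyer-19177),
# layer 2 (KY-reading), antecedent F-W «good member»: the NON-SPLIT member of a `ℚ`-isogeny class
# — the quotient by a MAXIMAL `Γ_ℚ`-stable cyclic `p`-power subgroup has EXACTLY ONE rational
# `p`-line, the image of `E[p]`, on which `Γ_ℚ` acts through `χ̄_p · χ_Φ⁻¹`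

Cell `bsd-schneider-ideate` (HOME `run/shared/lean/pub/bsd-schneider-ideate/`), seat `door-c4` gen 7.
PARTITION: board row B6 ∩ X3 ∩ sst-twist, r = 1, (G-ord, `e = 2`) cell; types-the-object-of the
antecedent «GoodMember(∀)» of the KY-reading of crux r3 (door-c3 g7, p472079
`xac_charIdeal_map_le_of_KY_OPEN`, memo `KY24b-anatomy-P2-g12.md` §4 "K-W"); closes nothing.
HONEST FRAMING: kernel lemmas on the Galois module `E[p]` along a `ℚ`-isogeny class; BSD is not
advanced; THEOREMS ONLY (no definition, no named fact, no `sorry`).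

## What is proved (file 1 of 2; sequel `SchneiderFreeAdditiveX3GoodMember.lean`)

* §1 `smul_smul_sub_cyclotomic_smul_mem_zmultiples` — **Mazur's (5.4) for an arbitrary rational
  line.** If `P ∈ E[p] ∖ {O}` spans a `Γ_ℚ`-stable line and `σP = aP`, then for every `S ∈ E[p]`
  `a·σS − χ̄_p(σ)·S ∈ ℤP`: `Γ_ℚ` acts on `E[p]/ℤP` through `χ̄_p · χ_Φ⁻¹` (`det ρ̄_{E,p} = χ̄_p`,
  Weil pairing — tree `det_eq_modPCyclotomicCharacterZMod_of_exists_weilPairing`,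
  `exists_weilPairing_holds`; the case `a = 1` is the tree's `smul_sub_cyclotomic_smul_mem_zmultiples`).
* §2 `exists_maximalCyclicQuotient` — **the non-split member.** For `E/ℚ` elliptic and a rational
  `p`-line `Φ ≤ E[p]`: let `ℤx ⊂ E(ℚ̄)` be a `Γ_ℚ`-stable CYCLIC subgroup of order `p^k` with
  `(ℤx)[p] = Φ` and `k` MAXIMAL (the orders are bounded: `X1.StableCyclicQuotient.bddAbove_setOf_stableCyclic`,
  Shafarevich *AEC* IX.6.2 = tree `finite_isogenyClass_holds`), and `E' = E/ℤx` a globally minimal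
  model (`exists_minimal_isogeny_ker_eq`, *AEC* III.4.12 = tree `exists_isogeny_ker_eq_and_comp_eq_nsmul_holds`).
  Then the quotient `g : E → E'` is cyclic of degree `p^k`, its restriction `g' : E[p] → E'[p]` has
  kernel `Φ`, its image `g'(E[p])` is a rational line, and EVERY rational `p`-line `Ψ` of `E'` equals
  `g'(E[p])`: a generator `q₀ = g(y)` has `p y = a x`; if `p ∣ a` then `y − (a/p)x ∈ E[p]` maps to
  `q₀`, so `Ψ = g'(E[p])`; if `p ∤ a` then `ℤy ⊃ ℤx` is stable cyclic of order `p^{k+1}` with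
  `(ℤy)[p] = Φ`, contradicting maximality. (The argument of the tree's
  `X1.GoodLatticeExists.exists_isIsogenous_noUnramifiedLine`, bsd-eis-ky gen 3, with the conclusion
  "`Ψ` is the image line" kept instead of being contradicted by a reduction-line datum.)
* §3 `smul_smul_map_eq_cyclotomic_smul` — on the image line, `a·σ(g'S) = χ̄_p(σ)·g'S` whenever
  `σ` has eigenvalue `a` on `Φ`.

References: B. Mazur, Publ. Math. IHÉS 47 (1977) Ch. III §5 (5.4) [Mazur1977]; J. H. Silverman,
*AEC* 2nd ed. III.4.12, III.8 (Weil pairing), VIII.8.3, IX.6.2 [SilvermanAEC2009]; T. Keller, M. Yin,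
arXiv:2410.23241 §3.1 (lattice normalisation and `E(K)[p] = 0` of Thm. 3.5.1) [KellerYin2024PotOrd];
HOME/memos/KY24b-anatomy-P2-g12.md §4.
-/

set_option linter.dupNamespace false
set_option autoImplicit false

noncomputable section

open scoped Classical

open WeierstrassCurve NumberField IsDedekindDomain Literature.NumberTheory.EllipticCurves
  Literature.NumberTheory.EllipticCurves.Rank1Residual
  Literature.NumberTheory.GaloisRepresentations Field
  Summit.BirchSwinnertonDyer.Rank1Residual.X1.StableCyclicQuotient

namespace Summit.BirchSwinnertonDyer.BirchSwinnertonDyer.Theorems.SchneiderFree.GoodMember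

variable {p : ℕ} [hp : Fact p.Prime]

/-! ## §1 Mazur's (5.4) for an arbitrary rational line: `Γ_ℚ` acts on `E[p]/Φ` by `χ̄_p · χ_Φ⁻¹` -/

/-- **`a·σS − χ̄_p(σ)·S ∈ ℤP` when `σP = aP`.** For `P ∈ E[p] ∖ {O}` (elliptic `E/ℚ`, `p` prime),
`σ ∈ Γ_ℚ` and `a ∈ ℤ` with `σ • P = a • P`, every `S ∈ E[p]` satisfies
`a • σS − χ̄_p(σ) • S ∈ ℤ·P`; i.e. if `ℤP` is a rational line with character `χ_Φ`, then `Γ_ℚ` acts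
on `E[p]/ℤP` through `χ̄_p χ_Φ⁻¹`. In a frame `e : E[p] ≃ 𝔽_p²` with `e P = (1, 0)` the matrix of
`σ` is `(a b; 0 d)` with `ad = det = χ̄_p(σ)` (Weil pairing), and
`a·σ(x, y) − ad·(x, y) = ((a² − ad)x + aby, 0)`. [cite: Mazur1977, Ch. III §5, (5.4), p. 157]
[cite: SilvermanCSS1997, Ch. II §7 Proposition (det ρ̄ = χ)] -/
theorem smul_smul_sub_cyclotomic_smul_mem_zmultiples {W : WeierstrassCurve ℚ} [W.IsElliptic]
    {P : geomTorsion W (p : ℤ)} (hP0 : P ≠ 0) (σ : absoluteGaloisGroup ℚ) {a : ℤ}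
    (hP : σ • P = a • P) (S : geomTorsion W (p : ℤ)) :
    a • (σ • S) - ((((modPCyclotomicCharacterZMod ℚ p σ : (ZMod p)ˣ) : ZMod p).val : ℤ)) • S ∈
      AddSubgroup.zmultiples P := by
  haveI : NeZero (p : ℚ) := ⟨Nat.cast_ne_zero.mpr hp.out.ne_zero⟩
  haveI : NeZero p := ⟨hp.out.ne_zero⟩
  obtain ⟨e, heP⟩ := exists_addEquiv_apply_eq_single W p hP0
  -- the matrix of `σ` in the frame `e`
  set M : Matrix (Fin 2) (Fin 2) (ZMod p) :=
    Matrix.of fun i j ↦ e (σ • e.symm (Pi.single j 1)) i with hM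
  have hMvec : ∀ T : geomTorsion W (p : ℤ), e (σ • T) = M.mulVec (e T) := by
    let f : (Fin 2 → ZMod p) →ₗ[ZMod p] (Fin 2 → ZMod p) :=
      (e.toAddMonoidHom.comp ((DistribSMul.toAddMonoidHom (geomTorsion W (p : ℤ)) σ).comp
        e.symm.toAddMonoidHom)).toZModLinearMap p
    have hf : ∀ v, f v = e (σ • e.symm v) := fun _ ↦ rfl
    have hfg : f = Matrix.mulVecLin M := by
      refine (Pi.basisFun (ZMod p) (Fin 2)).ext fun j ↦ ?_
      rw [Pi.basisFun_apply, hf, Matrix.mulVecLin_apply, Matrix.mulVec_single_one]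
      funext i
      rw [hM, Matrix.col_apply, Matrix.of_apply]
    intro T
    have h := congrArg (fun g : (Fin 2 → ZMod p) →ₗ[ZMod p] (Fin 2 → ZMod p) ↦ g (e T)) hfg
    simp only [hf, Matrix.mulVecLin_apply, AddEquiv.symm_apply_apply] at h
    exact h
  have hdet := det_eq_modPCyclotomicCharacterZMod_of_exists_weilPairing W p
    (exists_weilPairing_holds W p) e σ M hMvec
  -- the first column of `M` is `e (σ P) = e (a • P) = a • (1, 0)`
  have hcol : ∀ i, M i 0 = (a : ZMod p) * (Pi.single (0 : Fin 2) (1 : ZMod p) : Fin 2 → ZMod p) i := by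
    intro i
    rw [hM, Matrix.of_apply, ← heP, e.symm_apply_apply, hP, map_zsmul, Pi.smul_apply, zsmul_eq_mul]
  have h00 : M 0 0 = (a : ZMod p) := by rw [hcol]; simp
  have h10 : M 1 0 = 0 := by rw [hcol]; simp
  rw [Matrix.det_fin_two, h00, h10, mul_zero, sub_zero] at hdet
  -- `hdet : a * M 1 1 = χ`
  set χ : ZMod p := ((modPCyclotomicCharacterZMod ℚ p σ : (ZMod p)ˣ) : ZMod p) with hχ
  set c : ZMod p := (a : ZMod p) * ((a : ZMod p) * e S 0 + M 0 1 * e S 1) - χ * e S 0 with hc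
  suffices h : a • (σ • S) - (χ.val : ℤ) • S = (c.val : ℤ) • P from
    AddSubgroup.mem_zmultiples_iff.mpr ⟨c.val, h.symm⟩
  apply e.injective
  rw [map_sub, map_zsmul, map_zsmul, map_zsmul, hMvec, heP]
  funext i
  rw [Pi.sub_apply, Pi.smul_apply, Pi.smul_apply, Pi.smul_apply, zsmul_eq_mul, zsmul_eq_mul,
    zsmul_eq_mul, Int.cast_natCast, Int.cast_natCast, ZMod.natCast_zmod_val, ZMod.natCast_zmod_val]
  fin_cases i
  · simp [Matrix.mulVec, dotProduct, Fin.sum_univ_two, h00, hc]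
  · simp [Matrix.mulVec, dotProduct, Fin.sum_univ_two, h10]
    linear_combination (e S 1) * hdet

/-! ## §2 The quotient by a MAXIMAL stable cyclic `p`-power subgroup: the non-split member -/

section Main

variable {V : WeierstrassCurve ℚ} [V.IsElliptic]

omit [V.IsElliptic] in
/-- `ℤ·x` is finite and `Γ_ℚ`-stable when `x` has finite order and `σx ∈ ℤx` for all `σ`. [folklore] -/
private theorem zmultiples_finite_stable {x : V.geomPoints} {n : ℕ} (hn : n ≠ 0)
    (hord : addOrderOf x = n) (hstab : ∀ σ : absoluteGaloisGroup ℚ, σ • x ∈ AddSubgroup.zmultiples x) :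
    (AddSubgroup.zmultiples x : Set V.geomPoints).Finite ∧
      ∀ (σ : absoluteGaloisGroup ℚ) (P : V.geomPoints), P ∈ AddSubgroup.zmultiples x →
        σ • P ∈ AddSubgroup.zmultiples x := by
  refine ⟨?_, fun σ P hP ↦ ?_⟩
  · have : Finite (AddSubgroup.zmultiples x) := by
      apply Nat.finite_of_card_ne_zero; rw [Nat.card_zmultiples, hord]; exact hn
    exact Set.toFinite _
  · obtain ⟨m, rfl⟩ := AddSubgroup.mem_zmultiples_iff.mp hP
    rw [smul_comm σ m x]
    exact AddSubgroup.zsmul_mem _ (hstab σ) m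

/-- **The non-split member through a rational line.** Let `E/ℚ` be elliptic, `p` prime and
`Φ ≤ E[p]` a rational `p`-line (`IsRationalLine`). There are a globally minimal elliptic `E'/ℚ`, a
CYCLIC `ℚ`-isogeny `g : E → E'` of degree `p^k`, and the `Γ_ℚ`-equivariant restriction
`g' : E[p] → E'[p]` of `g`, with `ker g' = Φ`, such that the image `g'(E[p]) ≅ E[p]/Φ` is a rational
`p`-line of `E'` and is the ONLY one. Construction: `ker g = ℤx`, a `Γ_ℚ`-stable cyclic subgroup
of `E(ℚ̄)` of order `p^k` with `(ℤx)[p] = Φ` and `k` maximal (`bddAbove_setOf_stableCyclic`,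
Shafarevich); a second rational line of `E/ℤx` would lift to a stable cyclic `ℤy ⊋ ℤx` of order
`p^{k+1}` through `Φ`. [cite: SilvermanAEC2009, Prop. III.4.12 with Rem. III.4.13.2, Cor. IX.6.2]
[cite: KellerYin2024PotOrd, §3.1 (lattice with φ|G_p ≠ 1; the member is chosen in the isogeny class)] -/
theorem exists_maximalCyclicQuotient {Φ : AddSubgroup (geomTorsion V (p : ℤ))}
    (hΦ : IsRationalLine V p Φ) :
    ∃ (W : WeierstrassCurve ℚ) (_ : W.IsElliptic) (_ : W.IsGloballyMinimal) (g : Isogeny V W)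
      (g' : geomTorsion V (p : ℤ) →+ geomTorsion W (p : ℤ)) (k : ℕ),
      g.degree = p ^ k ∧ g.IsCyclic ∧
      (∀ P : geomTorsion V (p : ℤ), ((g' P : geomTorsion W (p : ℤ)) : W.geomPoints) = g (P : V.geomPoints)) ∧
      (∀ (σ : absoluteGaloisGroup ℚ) (P : geomTorsion V (p : ℤ)), g' (σ • P) = σ • g' P) ∧
      g'.ker = Φ ∧ IsRationalLine W p g'.range ∧
      ∀ Ψ : AddSubgroup (geomTorsion W (p : ℤ)), IsRationalLine W p Ψ → Ψ = g'.range := by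
  have hp' : p.Prime := hp.out
  have hpz : Prime (p : ℤ) := Int.prime_iff_natAbs_prime.mpr (by simpa using hp')
  -- the line `Φ' = Φ ⊂ E(ℚ̄)` and a generator
  set Φ' : AddSubgroup V.geomPoints := Φ.map (geomTorsion V (p : ℤ)).subtype with hΦ'
  have hΦ'card : Nat.card Φ' = p := Summit.BirchSwinnertonDyer.Rank1Residual.X2.IsogenyQuotientLine.natCard_map_subtype hΦ
  obtain ⟨x₀, hx₀Φ, hx₀0, hx₀ord, hx₀gen⟩ := exists_generator_of_prime_card (p := p) Φ' hΦ'card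
  -- the set of good orders is non-empty (k = 1) and bounded; take the maximum
  let T : Set ℕ := {k : ℕ | ∃ x : V.geomPoints, addOrderOf x = p ^ k ∧
    (∀ σ : absoluteGaloisGroup ℚ, σ • x ∈ AddSubgroup.zmultiples x) ∧
      p ^ (k - 1) • x ∈ Φ' ∧ p ^ (k - 1) • x ≠ 0}
  have h1T : 1 ∈ T := by
    refine ⟨x₀, by rw [pow_one]; exact hx₀ord, fun σ ↦ ?_,
      by rw [Nat.sub_self, pow_zero, one_smul]; exact hx₀Φ, by rw [Nat.sub_self, pow_zero, one_smul]; exact hx₀0⟩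
    rw [hx₀gen]
    obtain ⟨P, hP, rfl⟩ := hx₀Φ
    exact ⟨σ • P, hΦ.2 σ P hP, rfl⟩
  have hbdd : BddAbove T := by
    refine BddAbove.mono (fun k hk ↦ ?_) (bddAbove_setOf_stableCyclic (V := V) (p := p))
    obtain ⟨x, h1, h2, -⟩ := hk
    exact ⟨x, h1, h2⟩
  obtain ⟨x, hxord, hxstab, hxΦ, hx0⟩ : sSup T ∈ T := Nat.sSup_mem ⟨1, h1T⟩ hbdd
  set k := sSup T with hk
  have hk1 : 1 ≤ k := le_csSup hbdd h1T
  -- `t = p^{k-1} x` generates `Φ'`, of order `p`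
  set t : V.geomPoints := p ^ (k - 1) • x with ht
  have htgen : AddSubgroup.zmultiples t = Φ' := by
    have := eq_of_prime_card_of_mem (p := p) (H₁ := AddSubgroup.zmultiples t) (H₂ := Φ') ?_ hΦ'card hx0
      (AddSubgroup.mem_zmultiples t) hxΦ
    · exact this
    · rw [Nat.card_zmultiples]
      haveI : Finite Φ' := Nat.finite_of_card_ne_zero (by rw [hΦ'card]; exact hp'.ne_zero)
      have hdvd : addOrderOf (⟨t, hxΦ⟩ : Φ') ∣ p := by rw [← hΦ'card]; exact addOrderOf_dvd_natCard _
      rw [AddSubgroup.addOrderOf_mk] at hdvd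
      rcases (Nat.dvd_prime hp').mp hdvd with h | h
      · exact absurd (AddMonoid.addOrderOf_eq_one_iff.mp h) hx0
      · exact h
  have htord : addOrderOf t = p := by
    have h := congrArg (fun H : AddSubgroup V.geomPoints ↦ Nat.card H) htgen
    simp only [Nat.card_zmultiples] at h
    rw [h, hΦ'card]
  -- the quotient `E' = E/ℤx` (globally minimal model) and the restriction of `g` to `E[p]`
  obtain ⟨hfin, hst⟩ := zmultiples_finite_stable (V := V) (pow_ne_zero k hp'.ne_zero) hxord hxstab
  obtain ⟨W, hW, hWmin, g, hker⟩ := exists_minimal_isogeny_ker_eq (AddSubgroup.zmultiples x) hfin hst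
  haveI := hW
  obtain ⟨g', hg'val, hg'⟩ := Summit.BirchSwinnertonDyer.Rank1Residual.X2.IsogenyLineType.exists_restrict_torsion (p := p) g
  have hpkx : ((p : ℤ) ^ k) • x = 0 := by
    rw [← Nat.cast_pow, natCast_zsmul, ← hxord]; exact addOrderOf_nsmul_eq_zero x
  -- `ker g' = Φ`
  have hker' : g'.ker = Φ := by
    ext P
    rw [AddMonoidHom.mem_ker]
    constructor
    · intro hP
      have h1 : (P : V.geomPoints) ∈ g.toAddMonoidHom.ker := by
        rw [AddMonoidHom.mem_ker, Isogeny.coe_toAddMonoidHom, ← hg'val, hP]; rfl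
      rw [hker] at h1
      obtain ⟨m, hm⟩ := AddSubgroup.mem_zmultiples_iff.mp h1
      have hP0 : (p : ℤ) • (P : V.geomPoints) = 0 := (Submodule.mem_torsionBy_iff (p : ℤ) _).mp P.2
      have hdiv : (addOrderOf x : ℤ) ∣ p * m := by
        rw [addOrderOf_dvd_iff_zsmul_eq_zero, mul_smul, hm, hP0]
      rw [hxord, Nat.cast_pow] at hdiv
      obtain ⟨m', hm'⟩ : (p : ℤ) ^ (k - 1) ∣ m := by
        have hk' : k = (k - 1) + 1 := by omega
        have hdiv' : (p : ℤ) ^ (k - 1) * p ∣ m * p := by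
          rw [hk', pow_succ, mul_comm (p : ℤ) m] at hdiv; exact hdiv
        have hp0 : (p : ℤ) ≠ 0 := by exact_mod_cast hp'.ne_zero
        exact (mul_dvd_mul_iff_right hp0).mp hdiv'
      have hPt : (P : V.geomPoints) ∈ Φ' := by
        rw [← htgen, AddSubgroup.mem_zmultiples_iff]
        refine ⟨m', ?_⟩
        rw [ht, ← hm, hm', mul_comm, mul_smul, ← Nat.cast_pow, natCast_zsmul]
      obtain ⟨Q, hQ, hQP⟩ := hPt
      have : Q = P := Subtype.ext hQP
      exact this ▸ hQ
    · intro hP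
      have hPt : (P : V.geomPoints) ∈ Φ' := ⟨P, hP, rfl⟩
      rw [← htgen, AddSubgroup.mem_zmultiples_iff] at hPt
      obtain ⟨m, hm⟩ := hPt
      have h1 : (P : V.geomPoints) ∈ g.toAddMonoidHom.ker := by
        rw [hker, AddSubgroup.mem_zmultiples_iff]
        exact ⟨m * (p : ℤ) ^ (k - 1), by rw [mul_smul, ← hm, ht, ← Nat.cast_pow, natCast_zsmul]⟩
      rw [AddMonoidHom.mem_ker, Isogeny.coe_toAddMonoidHom, ← hg'val] at h1
      exact Subtype.ext h1
  have hK : Nat.card g'.ker = p := by rw [hker']; exact hΦ.1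
  have hrange : IsRationalLine W p g'.range :=
    isRationalLine_range g' hg' (Rank1Residual.natCard_geomTorsion V p) hK
  obtain ⟨hdeg, hcyc⟩ := degree_eq_addOrderOf_of_ker_eq g hker
  refine ⟨W, hW, hWmin, g, g', k, by rw [hdeg, hxord], hcyc, hg'val, hg', hker', hrange,
    fun Ψ hΨ ↦ ?_⟩
  -- uniqueness: a generator `q₀` of `Ψ` and a preimage `y`
  obtain ⟨q₀, hq₀Ψ, hq₀0, -, hq₀gen⟩ := exists_generator_of_prime_card (p := p) Ψ hΨ.1
  obtain ⟨y, hy⟩ := g.surjective (q₀ : W.geomPoints)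
  -- `p y ∈ ker g = ℤ x`: `a x = p y`
  have hpy : (p : ℤ) • y ∈ g.toAddMonoidHom.ker := by
    rw [AddMonoidHom.mem_ker, map_zsmul, Isogeny.coe_toAddMonoidHom, hy]
    have h0 : (p : ℤ) • (q₀ : W.geomPoints) = 0 := (Submodule.mem_torsionBy_iff (p : ℤ) _).mp q₀.2
    exact h0
  rw [hker] at hpy
  obtain ⟨a, ha⟩ := AddSubgroup.mem_zmultiples_iff.mp hpy
  by_cases hdvd : (p : ℤ) ∣ a
  · ---------------------------------------------------------------- `p ∣ a`: `Ψ` is the image of `E[p]`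
    obtain ⟨a', rfl⟩ := hdvd
    set z : V.geomPoints := y - a' • x with hz
    have hpz0 : (p : ℤ) • z = 0 := by
      rw [hz, smul_sub, ← ha, smul_smul]
      exact sub_self _
    have hzmem : z ∈ geomTorsion V (p : ℤ) := (Submodule.mem_torsionBy_iff (p : ℤ) _).mpr hpz0
    have hxker : x ∈ g.toAddMonoidHom.ker := by rw [hker]; exact AddSubgroup.mem_zmultiples x
    have hgz : g z = (q₀ : W.geomPoints) := by
      rw [hz, map_sub, map_zsmul, hy]
      rw [AddMonoidHom.mem_ker, Isogeny.coe_toAddMonoidHom] at hxker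
      rw [hxker, smul_zero, sub_zero]
    have hq₀range : q₀ ∈ g'.range := by
      refine ⟨⟨z, hzmem⟩, Subtype.ext ?_⟩
      rw [hg'val]; exact hgz
    exact (eq_of_prime_card_of_mem (p := p) hrange.1 hΨ.1 hq₀0 hq₀range hq₀Ψ).symm
  · ---------------------------------------------------------------- `p ∤ a`: `ℤy` is a bigger good subgroup
    exfalso
    have hcop : IsCoprime ((p : ℤ) ^ k) a := (IsCoprime.pow_left ((Prime.coprime_iff_not_dvd hpz).mpr hdvd))
    obtain ⟨u, v, huv⟩ := hcop
    have hxy : x ∈ AddSubgroup.zmultiples y := by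
      have : x = v • ((p : ℤ) • y) := by
        calc x = (u * (p : ℤ) ^ k + v * a) • x := by rw [huv, one_smul]
          _ = u • (((p : ℤ) ^ k) • x) + v • (a • x) := by rw [add_smul, mul_smul, mul_smul]
          _ = v • ((p : ℤ) • y) := by rw [hpkx, smul_zero, zero_add, ha]
      rw [this, smul_smul]
      exact AddSubgroup.zsmul_mem _ (AddSubgroup.mem_zmultiples y) _
    have hpky : p ^ k • y = a • t := by
      have hk' : k = (k - 1) + 1 := by omega
      calc p ^ k • y = ((p : ℤ) ^ (k - 1) * (p : ℤ)) • y := by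
              rw [← natCast_zsmul, Nat.cast_pow, ← pow_succ, ← hk']
        _ = ((p : ℤ) ^ (k - 1) * a) • x := by rw [mul_smul ((p : ℤ) ^ (k - 1)) (p : ℤ) y, ← ha, ← mul_smul]
        _ = a • t := by rw [mul_comm, mul_smul, ht, ← natCast_zsmul x (p ^ (k - 1)), Nat.cast_pow]
    have hat0 : a • t ≠ 0 := by
      intro h0
      apply hdvd
      have := addOrderOf_dvd_iff_zsmul_eq_zero.mpr h0
      rwa [htord] at this
    have hpk1y : p ^ (k + 1) • y = 0 := by
      calc p ^ (k + 1) • y = p • (p ^ k • y) := by rw [pow_succ', mul_smul]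
        _ = p • (a • t) := by rw [hpky]
        _ = a • (p • t) := smul_comm _ _ _
        _ = 0 := by rw [← htord, addOrderOf_nsmul_eq_zero, smul_zero]
    have hyord : addOrderOf y = p ^ (k + 1) :=
      addOrderOf_eq_prime_pow (by rw [hpky]; exact hat0) hpk1y
    -- `ℤ y` is `Γ_ℚ`-stable: `g(σ y) = σ q₀ = m q₀ = g(m y)`
    have hystab : ∀ σ : absoluteGaloisGroup ℚ, σ • y ∈ AddSubgroup.zmultiples y := by
      intro σ
      have hσq : σ • q₀ ∈ AddSubgroup.zmultiples q₀ := by rw [hq₀gen]; exact hΨ.2 σ q₀ hq₀Ψ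
      obtain ⟨m, hm⟩ := AddSubgroup.mem_zmultiples_iff.mp hσq
      have hdiff : σ • y - m • y ∈ g.toAddMonoidHom.ker := by
        rw [AddMonoidHom.mem_ker, map_sub, map_zsmul, Isogeny.coe_toAddMonoidHom, Isogeny.map_smul, hy,
          ← AddSubgroup.torsionBy.coe_smul, ← hm]
        simp
      rw [hker] at hdiff
      have hsub : AddSubgroup.zmultiples x ≤ AddSubgroup.zmultiples y := AddSubgroup.zmultiples_le_of_mem hxy
      have := hsub hdiff
      have h2 : σ • y = (σ • y - m • y) + m • y := by abel
      rw [h2]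
      exact AddSubgroup.add_mem _ this (AddSubgroup.zsmul_mem _ (AddSubgroup.mem_zmultiples y) m)
    -- hence `k + 1` is a good order: contradiction with maximality
    have hmem : k + 1 ∈ T := by
      refine ⟨y, hyord, hystab, ?_, ?_⟩
      · rw [Nat.add_sub_cancel, hpky, ← htgen]
        exact AddSubgroup.zsmul_mem _ (AddSubgroup.mem_zmultiples t) a
      · rw [Nat.add_sub_cancel, hpky]; exact hat0
    have : k + 1 ≤ k := hk ▸ le_csSup hbdd hmem
    omega

end Main

/-! ## §3 The action on the image line: `a·σ(g'S) = χ̄_p(σ)·g'S` -/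

/-- **`Γ_ℚ` acts on the image line through `χ̄_p · χ_Φ⁻¹`.** For a `Γ_ℚ`-equivariant
`g' : E[p] → E'[p]` killing the rational line `ℤP` (`P ≠ O`), `σ ∈ Γ_ℚ` with `σP = aP`, and any
`S ∈ E[p]`: `a • σ(g'S) = χ̄_p(σ) • g'S` (apply `g'` to §1). [cite: Mazur1977, Ch. III §5, (5.4), p. 157] -/
theorem smul_smul_map_eq_cyclotomic_smul {V W : WeierstrassCurve ℚ} [V.IsElliptic]
    (g' : geomTorsion V (p : ℤ) →+ geomTorsion W (p : ℤ))
    (hg' : ∀ (σ : absoluteGaloisGroup ℚ) (P : geomTorsion V (p : ℤ)), g' (σ • P) = σ • g' P)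
    {P : geomTorsion V (p : ℤ)} (hP0 : P ≠ 0) (hPker : g' P = 0)
    (σ : absoluteGaloisGroup ℚ) {a : ℤ} (hP : σ • P = a • P) (S : geomTorsion V (p : ℤ)) :
    a • (σ • g' S) = ((((modPCyclotomicCharacterZMod ℚ p σ : (ZMod p)ˣ) : ZMod p).val : ℤ)) • g' S := by
  have hmem := smul_smul_sub_cyclotomic_smul_mem_zmultiples (p := p) hP0 σ hP S
  obtain ⟨m, hm⟩ := AddSubgroup.mem_zmultiples_iff.mp hmem
  have h0 : g' (a • (σ • S) -
      ((((modPCyclotomicCharacterZMod ℚ p σ : (ZMod p)ˣ) : ZMod p).val : ℤ)) • S) = 0 := by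
    rw [← hm, map_zsmul, hPker, smul_zero]
  rw [map_sub, map_zsmul, map_zsmul, hg', sub_eq_zero] at h0
  exact h0

end Summit.BirchSwinnertonDyer.BirchSwinnertonDyer.Theorems.SchneiderFree.GoodMember

end
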